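import Summits.Ventures.HSemireg.UntwistDerivedTheta
import Mathlib.Algebra.Homology.DerivedCategory.ExactFunctor
import Mathlib.CategoryTheory.Localization.Adjunction
import Mathlib.CategoryTheory.Adjunction.FullyFaithful
import Mathlib.CategoryTheory.MorphismProperty.Basic
import HarnessLib

/-!
# Venture HSemireg — route R1.0 (i) on COMPLEX carriers: the derived pull-back `D(π^*)` is fully faithful
# (derived adjunction `D(F) ⊣ D(R)` of an exact adjoint pair, unit an isomorphism), and the kernel clause
# on `Hom_{D(X₀)}(E₀, E₀⟦2⟧)` with every categorical input of (i) derived from sheaf-level data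

HONEST FRAMING. Homological algebra on Mathlib's real derived categories (`DerivedCategory`,
`Functor.mapDerivedCategory` of an exact functor, `Adjunction.localization`), composed with
`UntwistDerivedTheta.lean`. No pull-back functor, no gerbe, no twist functor and no variety is constructed;
nothing here says HC, HC_CM or HC_AV is proved.

## Why this file (`UntwistDerivedTheta.lean`, «What is NOT proved here», first item)

For the route's two-term perfect complex `E₀` the comparison `θ` of R1.0 (i) lives on
`Hom_{D(Mod 𝒪_{X₀})}(E₀, E₀⟦2⟧)` (dimension `18` in the STEP-0 (C) data), and `UntwistDerivedTheta.lean` made it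
real from a functor `Ψ` that is full, faithful and commutes with the shifts, leaving «`Ψ = D(- ⊗ L^{∓1}) ∘ D(π^*)`
is full and faithful» as an input BY NAME (printed: the derived comparison `Rπ_*π^* = id`). This file DERIVES
the `D(π^*)` half of that input from SHEAF-LEVEL data of the shape the cell already uses for the `μ₂`-gerbe
`π : 𝔊₀ → X₀`: an adjunction `F ⊣ R` of EXACT functors between abelian categories (intended `π^* ⊣ π_*`;
`π^*` exact because `π` is flat, `π_*` exact because the gerbe is tame — THIS is where tameness enters
[AbramovichOlssonVistoli2008, Def. 3.1 / Thm. 3.2; Alper2013, Def. 3.1, published numbering]) whose unit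
`E → π_*π^*E` is an isomorphism (equivalently `π^*` fully faithful; the weight-`0` identification
[Lieblich2007, arXiv Lemma 2.1.1.12]). Printed form of the mechanism: for an adjoint pair `G ⊣ F` of additive
functors the termwise adjunction on complexes [GortzWedhorn2023, Rem. F.190, (F.45.1)–(F.45.2)] descends to
the derived categories, `(LG, RF)` an adjoint pair [GortzWedhorn2023, Prop. F.191 = Lipman (3.2.1)–(3.2.2)];
for EXACT functors `LG = D(G)`, `RF = D(F)` termwise.

## What is PROVED here (0 sorry, 0 named facts, no definitions — the adjunctions are built inside the proofs)

* `exists_adjunction_mapHomologicalComplex` — `F ⊣ R` additive between preadditive categories, any complex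
  shape `c`: there is an adjunction `F.mapHomologicalComplex c ⊣ R.mapHomologicalComplex c` whose unit and
  counit are `adj.unit`, `adj.counit` termwise (`Adjunction.mkOfUnitCounit` on
  `NatTrans.mapHomologicalComplex adj.unit / adj.counit`; the triangle identities hold termwise).
* `exists_adjunction_mapDerivedCategory` — `C₁`, `C₂` abelian with derived categories, `F ⊣ R` with BOTH
  functors exact: there is an adjunction `F.mapDerivedCategory ⊣ R.mapDerivedCategory` (Mathlib's
  `Adjunction.localization` of the previous one along the two localisation functors `Q`, the commuting squares
  being `Functor.mapDerivedCategoryFactors`), and if `adj.unit` is an isomorphism then so is the derived unit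
  (termwise isomorphism of complexes ⟹ `Q` of it is an isomorphism ⟹ every object of `D(C₁)` is `Q K` up to
  isomorphism). `nonempty_adjunction_mapDerivedCategory` records the adjunction alone.
* `full_mapDerivedCategory_of_isIso_unit`, `faithful_mapDerivedCategory_of_isIso_unit` (and the
  `…_of_full_faithful` forms, `F` full and faithful ⟹ unit iso) — **`D(F)` is full and faithful**
  (`Adjunction.fullyFaithfulLOfIsIsoUnit`). Intended: `D(π^*) : D(Mod 𝒪_{X₀}) → D(Mod 𝒪_{𝔊₀})` is fully
  faithful — the `Rπ_*π^* = id` comparison of lit-1 GERBE-SCOPE (P3), now a theorem in the exact adjoint pair.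
* `jointlyInjective_iff_complex_of_exactAdjunction_comp`, `jointlyInjective_univ_complex_of_exactAdjunction_comp`
  — THE KERNEL CLAUSE OF R1.0 FOR A COMPLEX `E₀` ON `X₀/S` with `Ψ := F.mapDerivedCategory ⋙ Φ′`, where
  `F ⊣ R` is an exact adjoint pair out of `Mod(𝒪_{X₀})` with `F` full and faithful (intended `π^* ⊣ π_*`) and
  `Φ′` is ANY additive, full, faithful, shift-commuting functor out of `D(C₂)` (intended `D(- ⊗ L^{∓1})`, the
  derived functor of an exact autoequivalence — full faithfulness of which is the SAME theorem applied to the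
  adjoint equivalence `(- ⊗ L^{∓1}) ⊣ (- ⊗ L^{±1})`, or p6's `DerivedEquivalenceTransport` input): joint
  injectivity of abstract components `σ_q` on `Hom_{D(X₀)}(E₀, E₀⟦2⟧)` versus `σ′_q` on
  `Hom(ΨE₀, (ΨE₀)⟦2⟧)` under the triangular (Leibniz) re-expansion with injective diagonal, every lower `I`;
  FULL map, consumed direction.
* `full_mapDerivedCategory_of_equivalence`, `faithful_mapDerivedCategory_of_equivalence` — the special case
  `Φe.functor ⊣ Φe.inverse` of an additive equivalence of abelian categories (intended `- ⊗ L^{∓1}`): its derived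
  functor is full and faithful; and `jointlyInjective_univ_complex_of_exactAdjunction_equivalence` — the FULL-map
  consumed direction with `Ψ := D(F) ⋙ D(Φe.functor)`, i.e. with BOTH halves of R1.0 (i) derived from sheaf-level
  data (`π^* ⊣ π_*` exact with `π^*` fully faithful; `- ⊗ L^{∓1}` an autoequivalence of `Mod(𝒪_{𝔊₀})`).

## What is NOT proved here (declared inputs)

* The functors themselves (`π^*`, `π_*`, `- ⊗ L^{∓1}`): no gerbe / twist functor in the tree; they enter as
  `F`, `R`, `Φ′` with the listed properties. Exactness of `π_*` = tameness (AOV 2008 / Alper 2013, QCoh as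
  printed; all-`𝒪`-module reading a seat derivation, `2 ∈ 𝒪^×` — see `UntwistGerbePullback.lean`).
* `σ_q` for complexes and the Leibniz rule (hypotheses, as in every th-4 file).
* WHICH CATEGORY: Mathlib's `D(Mod 𝒪_{X₀})`; the printed `Ext²(E₀, E₀)` is `Hom` in `D^b(Coh X₀)`, equal for
  bounded coherent `E₀` on noetherian `X₀` [GortzWedhorn2023, Thm. 22.42] (cf. `DerivedEquivalenceTransport.lean`,
  «WHICH CATEGORY»).

## References

* U. Görtz, T. Wedhorn, *Algebraic Geometry II: Cohomology of Schemes* (2023), App. F: Cor. F.183 (a functor with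
  an exact left adjoint preserves injectives and K-injectives), Rem. F.190 and Prop. F.191 (adjoint pair on
  complexes and on derived categories; = Lipman, *Notes on derived functors and Grothendieck duality*, (3.2.1),
  (3.2.2)), Thm. 22.42. [GortzWedhorn2023]
* M. Lieblich, Duke Math. J. 138 (2007); arXiv:math/0411337 Lemma 2.1.1.12. [Lieblich2007]
* D. Abramovich, M. Olsson, A. Vistoli, Ann. Inst. Fourier 58 (2008), Def. 3.1, Thm. 3.2.
  [AbramovichOlssonVistoli2008]
* J. Alper, Ann. Inst. Fourier 63 (2013), Def. 3.1, Prop. 4.5. [Alper2013]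
* R.-O. Buchweitz, H. Flenner, Compositio Math. 137 (2003), Def. 4.1, §5. [BuchweitzFlenner2003]
-/

open CategoryTheory CategoryTheory.Limits AlgebraicGeometry

namespace Summit.Ventures.HSemireg

/-! ### The termwise adjunction on complexes -/

section Complexes

universe v₁ v₂ u₁ u₂ uι

variable {ι : Type uι} {C₁ : Type u₁} [Category.{v₁} C₁] [Preadditive C₁]
  {C₂ : Type u₂} [Category.{v₂} C₂] [Preadditive C₂]
  {F : C₁ ⥤ C₂} {R : C₂ ⥤ C₁} [F.Additive] [R.Additive] (adj : F ⊣ R) (c : ComplexShape ι)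

/-- **An adjunction `F ⊣ R` of additive functors induces an adjunction between the functors on
complexes**, with unit and counit given termwise by those of `adj` (`NatTrans.mapHomologicalComplex`); the
triangle identities hold termwise. (Printed: the termwise adjunction isomorphism
`Hom(Y, F X) ⥲ Hom(G Y, X)` is an isomorphism of Hom-complexes, functorial in both variables.)
[cite: GortzWedhorn2023, Rem. F.190 (F.45.1)–(F.45.2)] -/
theorem exists_adjunction_mapHomologicalComplex :
    ∃ adj' : F.mapHomologicalComplex c ⊣ R.mapHomologicalComplex c,
      (∀ (K : HomologicalComplex C₁ c) (i : ι), (adj'.unit.app K).f i = adj.unit.app (K.X i)) ∧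
        ∀ (L : HomologicalComplex C₂ c) (i : ι), (adj'.counit.app L).f i = adj.counit.app (L.X i) :=
  ⟨Adjunction.mkOfUnitCounit
    { unit := NatTrans.mapHomologicalComplex adj.unit c
      counit := NatTrans.mapHomologicalComplex adj.counit c
      left_triangle := by
        ext K i
        simp only [NatTrans.comp_app, HomologicalComplex.comp_f, Functor.whiskerRight_app,
          Functor.associator_hom_app, Functor.whiskerLeft_app, HomologicalComplex.id_f,
          Functor.mapHomologicalComplex_map_f, NatTrans.mapHomologicalComplex_app_f]
        erw [Category.id_comp]
        exact adj.left_triangle_components _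
      right_triangle := by
        ext K i
        simp only [NatTrans.comp_app, HomologicalComplex.comp_f, Functor.whiskerRight_app,
          Functor.associator_inv_app, Functor.whiskerLeft_app, HomologicalComplex.id_f,
          Functor.mapHomologicalComplex_map_f, NatTrans.mapHomologicalComplex_app_f]
        erw [Category.id_comp]
        exact adj.right_triangle_components _ },
    fun _ _ => rfl, fun _ _ => rfl⟩

end Complexes

/-! ### The derived adjunction `D(F) ⊣ D(R)` of an exact adjoint pair; `D(F)` fully faithful -/

section Derived

universe w₁ w₂ v₁ v₂ u₁ u₂

variable {C₁ : Type u₁} [Category.{v₁} C₁] [Abelian C₁] [HasDerivedCategory.{w₁} C₁]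
  {C₂ : Type u₂} [Category.{v₂} C₂] [Abelian C₂] [HasDerivedCategory.{w₂} C₂]
  {F : C₁ ⥤ C₂} {R : C₂ ⥤ C₁} [F.Additive] [R.Additive]
  [PreservesFiniteLimits F] [PreservesFiniteColimits F]
  [PreservesFiniteLimits R] [PreservesFiniteColimits R] (adj : F ⊣ R)

include adj

/-- **The derived adjunction of an exact adjoint pair, and its unit.** For `F ⊣ R` with `F` and `R` EXACT
functors between abelian categories (so that `D(F) = F.mapDerivedCategory`, `D(R) = R.mapDerivedCategory` are
defined termwise), there is an adjunction `D(F) ⊣ D(R)` — Mathlib's `Adjunction.localization` of the termwise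
adjunction on complexes along the localisations `Q : C(Cᵢ) → D(Cᵢ)`, the commuting squares being
`Functor.mapDerivedCategoryFactors` — and if the unit of `adj` is an isomorphism (intended: `E ⥲ π_*π^*E`,
`π^*` fully faithful) then the derived unit is an isomorphism: on `Q K` it is `Q` of the termwise unit (an
isomorphism of complexes) composed with isomorphisms, and every object of `D(C₁)` is isomorphic to some `Q K`.
[cite: GortzWedhorn2023, Prop. F.191 (= Lipman (3.2.1)–(3.2.2)) and Rem. F.190] -/
theorem exists_adjunction_mapDerivedCategory :
    ∃ adj' : F.mapDerivedCategory ⊣ R.mapDerivedCategory, IsIso adj.unit → IsIso adj'.unit := by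
  obtain ⟨adjC, hunit, -⟩ := exists_adjunction_mapHomologicalComplex adj (ComplexShape.up ℤ)
  letI : CatCommSq (F.mapHomologicalComplex (ComplexShape.up ℤ)) DerivedCategory.Q DerivedCategory.Q
      F.mapDerivedCategory := ⟨F.mapDerivedCategoryFactors.symm⟩
  letI : CatCommSq (R.mapHomologicalComplex (ComplexShape.up ℤ)) DerivedCategory.Q DerivedCategory.Q
      R.mapDerivedCategory := ⟨R.mapDerivedCategoryFactors.symm⟩
  refine ⟨adjC.localization DerivedCategory.Q (HomologicalComplex.quasiIso C₁ (ComplexShape.up ℤ))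
    DerivedCategory.Q (HomologicalComplex.quasiIso C₂ (ComplexShape.up ℤ))
    F.mapDerivedCategory R.mapDerivedCategory, fun hη => ?_⟩
  have hQ : ∀ K : CochainComplex C₁ ℤ, IsIso ((adjC.localization DerivedCategory.Q
      (HomologicalComplex.quasiIso C₁ (ComplexShape.up ℤ)) DerivedCategory.Q
      (HomologicalComplex.quasiIso C₂ (ComplexShape.up ℤ)) F.mapDerivedCategory
      R.mapDerivedCategory).unit.app (DerivedCategory.Q.obj K)) := fun K => by
    haveI : ∀ i, IsIso ((adjC.unit.app K).f i) := fun i => by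
      rw [hunit]
      exact (inferInstance : IsIso (adj.unit.app (K.X i)))
    haveI : IsIso (adjC.unit.app K) := HomologicalComplex.Hom.isIso_of_components _
    rw [Adjunction.localization_unit_app]
    haveI h1 : IsIso (DerivedCategory.Q.map (adjC.unit.app K)) := Functor.map_isIso _ _
    haveI h2 : IsIso ((CatCommSq.iso (R.mapHomologicalComplex (ComplexShape.up ℤ)) DerivedCategory.Q
        DerivedCategory.Q R.mapDerivedCategory).app
          ((F.mapHomologicalComplex (ComplexShape.up ℤ)).obj K)).hom := Iso.isIso_hom _
    haveI h3 : IsIso (R.mapDerivedCategory.map ((CatCommSq.iso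
        (F.mapHomologicalComplex (ComplexShape.up ℤ)) DerivedCategory.Q DerivedCategory.Q
          F.mapDerivedCategory).app K).hom) := Functor.map_isIso _ _
    exact @IsIso.comp_isIso _ _ _ _ _ _ _ h1 (@IsIso.comp_isIso _ _ _ _ _ _ _ h2 h3)
  haveI : ∀ Y : DerivedCategory C₁, IsIso ((adjC.localization DerivedCategory.Q
      (HomologicalComplex.quasiIso C₁ (ComplexShape.up ℤ)) DerivedCategory.Q
      (HomologicalComplex.quasiIso C₂ (ComplexShape.up ℤ)) F.mapDerivedCategory
      R.mapDerivedCategory).unit.app Y) := fun Y =>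
    (NatTrans.isIso_app_iff_of_iso _ (DerivedCategory.Q.objObjPreimageIso Y)).1 (hQ _)
  exact NatIso.isIso_of_isIso_app _

/-- **`D(F) ⊣ D(R)`** for an exact adjoint pair `F ⊣ R` (the adjunction alone).
[cite: GortzWedhorn2023, Prop. F.191] -/
theorem nonempty_adjunction_mapDerivedCategory :
    Nonempty (F.mapDerivedCategory ⊣ R.mapDerivedCategory) :=
  ⟨(exists_adjunction_mapDerivedCategory adj).choose⟩

/-- **`D(F)` is FULL when the unit of the exact adjoint pair `F ⊣ R` is an isomorphism** (a left adjoint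
with invertible unit is fully faithful). Intended: `D(π^*) : D(Mod 𝒪_{X₀}) → D(Mod 𝒪_{𝔊₀})` for the tame
`μ₂`-gerbe. [cite: GortzWedhorn2023, Prop. F.191; Lieblich2007, arXiv Lemma 2.1.1.12 (π^*π_* on weight 0)] -/
theorem full_mapDerivedCategory_of_isIso_unit [IsIso adj.unit] : F.mapDerivedCategory.Full := by
  obtain ⟨adj', h⟩ := exists_adjunction_mapDerivedCategory adj
  haveI := h inferInstance
  exact adj'.fullyFaithfulLOfIsIsoUnit.full

/-- **`D(F)` is FAITHFUL when the unit of the exact adjoint pair `F ⊣ R` is an isomorphism.**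
[cite: GortzWedhorn2023, Prop. F.191] -/
theorem faithful_mapDerivedCategory_of_isIso_unit [IsIso adj.unit] : F.mapDerivedCategory.Faithful := by
  obtain ⟨adj', h⟩ := exists_adjunction_mapDerivedCategory adj
  haveI := h inferInstance
  exact adj'.fullyFaithfulLOfIsIsoUnit.faithful

/-- **`D(F)` is full for `F` full, faithful, exact with an exact right adjoint** (`F` fully faithful ⟺ the
unit of `F ⊣ R` is an isomorphism). [cite: GortzWedhorn2023, Prop. F.191 and Prop. F.22] -/
theorem full_mapDerivedCategory_of_full_faithful [F.Full] [F.Faithful] : F.mapDerivedCategory.Full :=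
  full_mapDerivedCategory_of_isIso_unit adj

/-- **`D(F)` is faithful for `F` full, faithful, exact with an exact right adjoint.**
[cite: GortzWedhorn2023, Prop. F.191 and Prop. F.22] -/
theorem faithful_mapDerivedCategory_of_full_faithful [F.Full] [F.Faithful] :
    F.mapDerivedCategory.Faithful :=
  faithful_mapDerivedCategory_of_isIso_unit adj

end Derived

/-! ### The kernel clause of R1.0 for a complex `E₀` on `X₀/S`, with `D(π^*)` derived -/

section Schemes

universe w w₂ v₂ v' u u₂ u'

variable {S : Type u} [CommRing S] {X₀ : Over (Spec (CommRingCat.of S))}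
  [HasDerivedCategory.{w} X₀.left.Modules]
  {C₂ : Type u₂} [Category.{v₂} C₂] [Abelian C₂] [HasDerivedCategory.{w₂} C₂]
  {F : X₀.left.Modules ⥤ C₂} {R : C₂ ⥤ X₀.left.Modules} [F.Additive] [R.Additive]
  [PreservesFiniteLimits F] [PreservesFiniteColimits F]
  [PreservesFiniteLimits R] [PreservesFiniteColimits R] (adj : F ⊣ R) [F.Full] [F.Faithful]
  {D' : Type u'} [Category.{v'} D'] [Preadditive D'] [HasShift D' ℤ]
  (Φ' : DerivedCategory C₂ ⥤ D') [Φ'.Additive] [Φ'.CommShift ℤ] [Φ'.Full] [Φ'.Faithful]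
  (E₀ : CochainComplex X₀.left.Modules ℤ)
  {W W' : ℕ → Type*} [∀ q, AddCommGroup (W q)] [∀ q, AddCommGroup (W' q)]
  {σ : ∀ q, (DerivedCategory.Q.obj E₀ ⟶ (DerivedCategory.Q.obj E₀)⟦(2 : ℤ)⟧) →+ W q}
  {σ' : ∀ q, ((F.mapDerivedCategory ⋙ Φ').obj (DerivedCategory.Q.obj E₀) ⟶
    ((F.mapDerivedCategory ⋙ Φ').obj (DerivedCategory.Q.obj E₀))⟦(2 : ℤ)⟧) →+ W' q}

include adj

/-- **Kernel clause of R1.0 for a COMPLEX `E₀`, the pull-back half derived.** `E₀` any cochain complex of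
`𝒪_{X₀}`-modules (intended: the two-term perfect complex `Φ(I_p ⊠ I_q)`; `Hom_{D(X₀)}(E₀, E₀⟦2⟧)` of dimension
`18`); `F ⊣ R` an adjoint pair of EXACT functors out of `Mod(𝒪_{X₀})` with `F` full and faithful (intended
`π^* ⊣ π_*` for the tame `μ₂`-gerbe, `π^*π_* = id` on weight `0`), so that `D(F)` is full and faithful by
`full_mapDerivedCategory_of_full_faithful` / `faithful_…`; `Φ′` any additive, full, faithful, shift-commuting
functor on `D(C₂)` (intended `D(- ⊗ L^{∓1})`); `Ψ := D(F) ⋙ Φ′` (intended `E₀ ↦ E₀′ = π^*E₀ ⊗ L^{∓1}`);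
abstract components `σ_q` on `Hom(E₀, E₀⟦2⟧)`, `σ′_q` on `Hom(ΨE₀, (ΨE₀)⟦2⟧)` related through the real
`θ x = Ψ x ≫ (Ψ.commShiftIso 2)_{E₀}` triangularly on a lower set `I` with injective diagonal (the Leibniz rule
and `π^*` on Hodge cohomology, hypotheses). Then `(σ_q)_{q ∈ I}` is jointly injective iff `(σ′_q)_{q ∈ I}` is.
[cite: BuchweitzFlenner2003, §5 (I-semiregular); GortzWedhorn2023, Prop. F.191; Lieblich2007, arXiv Lemma
2.1.1.12] -/
theorem jointlyInjective_iff_complex_of_exactAdjunction_comp (d : ∀ q, W q →+ W' q)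
    (u : ∀ q j, W j →+ W' q) {I : Set ℕ} (hI : IsLowerSet I)
    (hd : ∀ q ∈ I, Function.Injective (d q))
    (hσ : ∀ q ∈ I, ∀ x : DerivedCategory.Q.obj E₀ ⟶ (DerivedCategory.Q.obj E₀)⟦(2 : ℤ)⟧,
      σ' q ((F.mapDerivedCategory ⋙ Φ').map x ≫
        (((F.mapDerivedCategory ⋙ Φ').commShiftIso (2 : ℤ)).app _).hom) =
        d q (σ q x) + ∑ j ∈ Finset.range q, u q j (σ j x)) :
    (∀ x : DerivedCategory.Q.obj E₀ ⟶ (DerivedCategory.Q.obj E₀)⟦(2 : ℤ)⟧,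
        (∀ q ∈ I, σ q x = 0) → x = 0) ↔
      ∀ x' : (F.mapDerivedCategory ⋙ Φ').obj (DerivedCategory.Q.obj E₀) ⟶
          ((F.mapDerivedCategory ⋙ Φ').obj (DerivedCategory.Q.obj E₀))⟦(2 : ℤ)⟧,
        (∀ q ∈ I, σ' q x' = 0) → x' = 0 := by
  haveI := full_mapDerivedCategory_of_full_faithful adj
  haveI := faithful_mapDerivedCategory_of_full_faithful adj
  exact jointlyInjective_iff_complex_of_fullyFaithful_commShift (F.mapDerivedCategory ⋙ Φ') E₀ d u hI hd hσ

/-- **FULL map, consumed direction, for a complex `E₀`, the pull-back half derived**: all `σ_q^{E₀}` jointly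
injective on `Hom_{D(X₀)}(E₀, E₀⟦2⟧)` (intended: FULL `σ_{E₀}` injective — the engines' certificate) ⟹ all
`σ′_q` jointly injective on `Hom(ΨE₀, (ΨE₀)⟦2⟧)` for `Ψ = D(F) ⋙ Φ′` (intended: `E₀′` fully semiregular on the
gerbe), given the exact adjoint pair `F ⊣ R` with `F` full and faithful, `Φ′` full faithful shift-commuting,
injective diagonals and the Leibniz-rule re-expansion. [cite: BuchweitzFlenner2003, Def. 4.1 and §5;
GortzWedhorn2023, Prop. F.191] -/
theorem jointlyInjective_univ_complex_of_exactAdjunction_comp (d : ∀ q, W q →+ W' q)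
    (u : ∀ q j, W j →+ W' q) (hd : ∀ q, Function.Injective (d q))
    (hσ : ∀ (q : ℕ) (x : DerivedCategory.Q.obj E₀ ⟶ (DerivedCategory.Q.obj E₀)⟦(2 : ℤ)⟧),
      σ' q ((F.mapDerivedCategory ⋙ Φ').map x ≫
        (((F.mapDerivedCategory ⋙ Φ').commShiftIso (2 : ℤ)).app _).hom) =
        d q (σ q x) + ∑ j ∈ Finset.range q, u q j (σ j x))
    (h : ∀ x : DerivedCategory.Q.obj E₀ ⟶ (DerivedCategory.Q.obj E₀)⟦(2 : ℤ)⟧, (∀ q, σ q x = 0) → x = 0)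
    (x' : (F.mapDerivedCategory ⋙ Φ').obj (DerivedCategory.Q.obj E₀) ⟶
      ((F.mapDerivedCategory ⋙ Φ').obj (DerivedCategory.Q.obj E₀))⟦(2 : ℤ)⟧)
    (hx' : ∀ q, σ' q x' = 0) : x' = 0 := by
  haveI := full_mapDerivedCategory_of_full_faithful adj
  haveI := faithful_mapDerivedCategory_of_full_faithful adj
  exact jointlyInjective_univ_complex_of_fullyFaithful_commShift (F.mapDerivedCategory ⋙ Φ') E₀ d u hd hσ
    h x' hx'

end Schemes

/-! ### The untwist `- ⊗ L^{∓1}` as well: the derived functor of an exact autoequivalence is fully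
faithful, and the kernel clause with BOTH halves of `Ψ` derived from sheaf-level data -/

section Equivalence

universe w₂ w₃ v₂ v₃ u₂ u₃

variable {C₂ : Type u₂} [Category.{v₂} C₂] [Abelian C₂] [HasDerivedCategory.{w₂} C₂]
  {C₃ : Type u₃} [Category.{v₃} C₃] [Abelian C₃] [HasDerivedCategory.{w₃} C₃]
  (Φe : C₂ ≌ C₃) [Φe.functor.Additive] [Φe.inverse.Additive]

/-- **The derived functor of an (additive) equivalence of abelian categories is FULL** — the special case
`F ⊣ R := Φe.functor ⊣ Φe.inverse` (both exact, unit an isomorphism) of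
`full_mapDerivedCategory_of_full_faithful`. Intended: `Φe = - ⊗ L^{∓1}` on `Mod(𝒪_{𝔊₀})` (inverse
`- ⊗ L^{±1}`), so that `D(- ⊗ L^{∓1})` is full. [cite: GortzWedhorn2023, Prop. F.191] -/
theorem full_mapDerivedCategory_of_equivalence : Φe.functor.mapDerivedCategory.Full :=
  full_mapDerivedCategory_of_full_faithful Φe.toAdjunction

/-- **The derived functor of an (additive) equivalence of abelian categories is FAITHFUL.**
[cite: GortzWedhorn2023, Prop. F.191] -/
theorem faithful_mapDerivedCategory_of_equivalence : Φe.functor.mapDerivedCategory.Faithful :=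
  faithful_mapDerivedCategory_of_full_faithful Φe.toAdjunction

end Equivalence

section SchemesEquivalence

universe w w₂ w₃ v₂ v₃ u u₂ u₃

variable {S : Type u} [CommRing S] {X₀ : Over (Spec (CommRingCat.of S))}
  [HasDerivedCategory.{w} X₀.left.Modules]
  {C₂ : Type u₂} [Category.{v₂} C₂] [Abelian C₂] [HasDerivedCategory.{w₂} C₂]
  {C₃ : Type u₃} [Category.{v₃} C₃] [Abelian C₃] [HasDerivedCategory.{w₃} C₃]
  {F : X₀.left.Modules ⥤ C₂} {R : C₂ ⥤ X₀.left.Modules} [F.Additive] [R.Additive]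
  [PreservesFiniteLimits F] [PreservesFiniteColimits F]
  [PreservesFiniteLimits R] [PreservesFiniteColimits R] (adj : F ⊣ R) [F.Full] [F.Faithful]
  (Φe : C₂ ≌ C₃) [Φe.functor.Additive] [Φe.inverse.Additive]
  (E₀ : CochainComplex X₀.left.Modules ℤ)
  {W W' : ℕ → Type*} [∀ q, AddCommGroup (W q)] [∀ q, AddCommGroup (W' q)]
  {σ : ∀ q, (DerivedCategory.Q.obj E₀ ⟶ (DerivedCategory.Q.obj E₀)⟦(2 : ℤ)⟧) →+ W q}
  {σ' : ∀ q, ((F.mapDerivedCategory ⋙ Φe.functor.mapDerivedCategory).obj (DerivedCategory.Q.obj E₀) ⟶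
    ((F.mapDerivedCategory ⋙ Φe.functor.mapDerivedCategory).obj (DerivedCategory.Q.obj E₀))⟦(2 : ℤ)⟧) →+
      W' q}

include adj

/-- **FULL map, consumed direction, for a complex `E₀` on `X₀/S`, with BOTH halves of `Ψ` derived from
sheaf-level data.** `Ψ := D(F) ⋙ D(Φe.functor)` for an exact adjoint pair `F ⊣ R` out of `Mod(𝒪_{X₀})` with
`F` full and faithful (intended `π^* ⊣ π_*`: `π` flat, `π_*` exact = tame gerbe, `π^*π_* = id` on weight `0`)
and an additive equivalence of abelian categories `Φe : C₂ ≌ C₃` (intended the untwist `- ⊗ L^{∓1}` on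
`Mod(𝒪_{𝔊₀})`, `L` the tautological root, `L² = π^*P`, `c₁(L) = c₁(P)/2`): all `σ_q^{E₀}` jointly injective
on `Hom_{D(X₀)}(E₀, E₀⟦2⟧)` ⟹ all `σ′_q` jointly injective on `Hom(ΨE₀, (ΨE₀)⟦2⟧)` (intended:
`E₀′ = π^*E₀ ⊗ L^{∓1}` fully semiregular on `𝔊₀`), given injective diagonals (intended `π^*` on
`H^{q+2}(Ω^q)`) and the Leibniz-rule re-expansion (hypotheses). The ONLY categorical inputs are now the two
sheaf-level functorial data; no derived-category input remains. [cite: BuchweitzFlenner2003, Def. 4.1 and §5;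
GortzWedhorn2023, Prop. F.191; Lieblich2007, arXiv Lemma 2.1.1.12] -/
theorem jointlyInjective_univ_complex_of_exactAdjunction_equivalence (d : ∀ q, W q →+ W' q)
    (u : ∀ q j, W j →+ W' q) (hd : ∀ q, Function.Injective (d q))
    (hσ : ∀ (q : ℕ) (x : DerivedCategory.Q.obj E₀ ⟶ (DerivedCategory.Q.obj E₀)⟦(2 : ℤ)⟧),
      σ' q ((F.mapDerivedCategory ⋙ Φe.functor.mapDerivedCategory).map x ≫
        (((F.mapDerivedCategory ⋙ Φe.functor.mapDerivedCategory).commShiftIso (2 : ℤ)).app _).hom) =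
        d q (σ q x) + ∑ j ∈ Finset.range q, u q j (σ j x))
    (h : ∀ x : DerivedCategory.Q.obj E₀ ⟶ (DerivedCategory.Q.obj E₀)⟦(2 : ℤ)⟧, (∀ q, σ q x = 0) → x = 0)
    (x' : (F.mapDerivedCategory ⋙ Φe.functor.mapDerivedCategory).obj (DerivedCategory.Q.obj E₀) ⟶
      ((F.mapDerivedCategory ⋙ Φe.functor.mapDerivedCategory).obj (DerivedCategory.Q.obj E₀))⟦(2 : ℤ)⟧)
    (hx' : ∀ q, σ' q x' = 0) : x' = 0 := by
  haveI := full_mapDerivedCategory_of_equivalence Φe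
  haveI := faithful_mapDerivedCategory_of_equivalence Φe
  exact jointlyInjective_univ_complex_of_exactAdjunction_comp adj Φe.functor.mapDerivedCategory E₀ d u hd
    hσ h x' hx'

end SchemesEquivalence

end Summit.Ventures.HSemireg
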